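import Literature.Computability.AlgebraicComplexity.BorderApolarityPerturb
import Literature.Computability.AlgebraicComplexity.BorderRankMatMulTwoWeights
import Literature.Computability.AlgebraicComplexity.BorderRankMatMulThreeHalves
import HarnessLib

/-!
# `R̲(⟨2,2,2⟩) ≥ 7` over every field of characteristic `0` — proved (torus-fixed border apolarity)

Topic `Literature/Computability/AlgebraicComplexity`.  The lower bound of Landsberg's theorem
"the border rank of the multiplication of `2 × 2` matrices is seven" (J. Amer. Math. Soc. 19
(2006); first hand-checkable algebraic proof: Conner–Harper–Landsberg 2023, §5, by border
apolarity), for the tree's ALGEBRAIC border rank `algBorderRank` over `K[ε]` (`SchoenhageTau.lean`)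
and every field `K` of characteristic `0`:

* `MatMulTwo.seven_le_algBorderRank_matMulTensor_two : 7 ≤ algBorderRank (matMulTensor K 2 2 2)`.

## The proof (CHL 2023, §2.3–§3 and §5, made elementary and torus-only)

Suppose `R̲(⟨2,2,2⟩) ≤ 6`; with the tree's `6 ≤ R̲` there is an order-`h` approximate
decomposition with exactly `6` triads `(u_ρ, v_ρ, w_ρ)` over `K[ε]` (slots: `u` = output `C`,
`v` = `A`, `w` = `B`).  Perturb `v, w` by `εᴺ e` at six distinct coordinate pairs (`N` beyond
`h` and all degrees; `BorderApolarityPerturb.lean`): still a decomposition, now with the six points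
`(v_ρ, w_ρ) ∈ A × B` in general position for the `(2,1)`- and `(1,2)`-forms over `L = K(ε)`.
Let `F = lim_{ε→0} I₁₁₀ ≤ K^{A* ⊗ B*}` (`BorderApolarityLimits.lean`).  Then (CHL §2.3 (i)–(iii))
`dim F ≥ 16 − 6 = 10`, `F ≤ M⟨2⟩(C*)^⊥`, `dim (F · A*) ≤ dim I₂₁₀ ≤ 40 − 6 = 34` and
`dim (F · B*) ≤ 34`.  Degenerate along the one-parameter subgroup with weights
`deg((i,j),(j',k)) = 6i − 2j + 2j' + k` (`GradedInitialSubspace.lean`,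
`BorderRankMatMulTwoWeights.lean`): the initial subspace
`in(F) = ⊕_d in_d(F)` has `dim = dim F ≥ 10`, lies in `M⟨2⟩(C*)^⊥` degree by degree — whose
graded pieces are the `12` weight LINES `K ω_k` — hence contains `≥ 10` of the weight vectors
`ω_k`, and `in(F) · A* ≤ in(F · A*)`, `dim in(F · A*) ≤ dim (F · A*) ≤ 34` (likewise for `B*`).
But by the kernel-checked certificate `MatMulTwo.rank_test_ge` (`BorderRankMatMulTwoCert.lean`)
any `10` of the `ω_k` have `(210)`-products or `(120)`-products spanning dimension `≥ 35`.

## References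

* J. M. Landsberg, *The border rank of the multiplication of 2 × 2 matrices is seven*, J. Amer.
  Math. Soc. 19 (2006) 447–459 — the theorem. [Landsberg2005]
* A. Conner, A. Harper, J. M. Landsberg, *New lower bounds for matrix multiplication and `det₃`*,
  Forum Math. Pi 11 (2023) e17 = arXiv:1911.07981, §2.3–§2.5, §3, §4, §5 ("Here is a very short
  algebraic proof that `R̲(M⟨2⟩) = 7` … no `𝔹`-fixed six dimensional `F₁₁₀` … passes both the
  `(210)` and `(120)` tests"). [ConnerHarperLandsberg2023]

## Design

No Borel fixed point theorem / Lie's theorem and no Hilbert scheme: the torus normal form is the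
initial-subspace count of `GradedInitialSubspace.lean`, and unipotent normalisation is replaced by
checking all `66` torus-fixed candidates instead of CHL's `3` Borel-fixed ones.
-/

noncomputable section

open scoped BigOperators Polynomial
open Polynomial

namespace Literature.Computability.AlgebraicComplexity

namespace MatMulTwo

universe u

/-! ## `dim Sym ≤ 40` -/

section SymBound

variable (L : Type u) [Field L]

/-- The coordinates `(a, a', b)` with `a ≤ a'` number `40`. [folklore] -/
theorem card_ordA : Fintype.card {t : P2 × P2 × P2 // encP t.1 ≤ encP t.2.1} = 40 := by rfl

/-- The coordinates `(a, b, b')` with `b ≤ b'` number `40`. [folklore] -/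
theorem card_ordB : Fintype.card {t : P2 × P2 × P2 // encP t.2.1 ≤ encP t.2.2} = 40 := by rfl

/-- `dim S²A* ⊗ B* ≤ 40` for `⟨2,2,2⟩` (symmetric tensors are determined by their coordinates with
`a ≤ a'`). [folklore] -/
theorem finrank_symA_le : Module.finrank L (symA L (α := P2) (β := P2)) ≤ 40 := by
  let res : symA L (α := P2) (β := P2) →ₗ[L] ({t : P2 × P2 × P2 // encP t.1 ≤ encP t.2.1} → L) :=
    { toFun := fun γ t => (γ : P2 × P2 × P2 → L) t.1
      map_add' := fun _ _ => rfl
      map_smul' := fun _ _ => rfl }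
  have hinj : Function.Injective res := by
    intro γ γ' hγ
    apply Subtype.ext
    funext ⟨a, a', b⟩
    rcases le_total (encP a) (encP a') with hle | hle
    · exact congr_fun hγ ⟨(a, a', b), hle⟩
    · have h1 : (γ : P2 × P2 × P2 → L) (a', a, b) = (γ' : P2 × P2 × P2 → L) (a', a, b) :=
        congr_fun hγ ⟨(a', a, b), hle⟩
      rw [γ.2 a a' b, γ'.2 a a' b]
      exact h1
  calc Module.finrank L (symA L (α := P2) (β := P2))
      ≤ Module.finrank L ({t : P2 × P2 × P2 // encP t.1 ≤ encP t.2.1} → L) :=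
        LinearMap.finrank_le_finrank_of_injective hinj
    _ = 40 := by rw [Module.finrank_fintype_fun_eq_card, card_ordA]

/-- `dim A* ⊗ S²B* ≤ 40` for `⟨2,2,2⟩`. [folklore] -/
theorem finrank_symB_le : Module.finrank L (symB L (α := P2) (β := P2)) ≤ 40 := by
  let res : symB L (α := P2) (β := P2) →ₗ[L] ({t : P2 × P2 × P2 // encP t.2.1 ≤ encP t.2.2} → L) :=
    { toFun := fun γ t => (γ : P2 × P2 × P2 → L) t.1
      map_add' := fun _ _ => rfl
      map_smul' := fun _ _ => rfl }
  have hinj : Function.Injective res := by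
    intro γ γ' hγ
    apply Subtype.ext
    funext ⟨a, b, b'⟩
    rcases le_total (encP b) (encP b') with hle | hle
    · exact congr_fun hγ ⟨(a, b, b'), hle⟩
    · have h1 : (γ : P2 × P2 × P2 → L) (a, b', b) = (γ' : P2 × P2 × P2 → L) (a, b', b) :=
        congr_fun hγ ⟨(a, b', b), hle⟩
      rw [γ.2 a b b', γ'.2 a b b']
      exact h1
  calc Module.finrank L (symB L (α := P2) (β := P2))
      ≤ Module.finrank L ({t : P2 × P2 × P2 // encP t.2.1 ≤ encP t.2.2} → L) :=
        LinearMap.finrank_le_finrank_of_injective hinj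
    _ = 40 := by rw [Module.finrank_fintype_fun_eq_card, card_ordB]

end SymBound

/-! ## The theorem -/

section Main

variable (K : Type u) [Field K] [CharZero K]

omit [CharZero K] in
/-- The test products are the `(210)`/`(120)` products of the weight vectors. [folklore] -/
theorem rowFun_false (k : Fin 12) (a₀ : P2) : rowFun K false k a₀ = mul210 K a₀ (wv K k) := by
  funext t; simp [rowFun]

omit [CharZero K] in
/-- The test products are the `(210)`/`(120)` products of the weight vectors. [folklore] -/
theorem rowFun_true (k : Fin 12) (b₀ : P2) : rowFun K true k b₀ = mul120 K b₀ (wv K k) := by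
  funext t; simp [rowFun]

/-- **`R̲(⟨2,2,2⟩) ≥ 7` over every field of characteristic `0`** (Landsberg 2006; here by the
torus-fixed border apolarity argument described in the module docstring, after
Conner–Harper–Landsberg 2023, §5), for the algebraic border rank over `K[ε]`.
[cite: Landsberg2005, main theorem (p. 447)] [cite: ConnerHarperLandsberg2023, §5] -/
theorem seven_le_algBorderRank_matMulTensor_two : 7 ≤ algBorderRank (matMulTensor K 2 2 2) := by
  classical
  set t := matMulTensor K 2 2 2 with ht
  by_contra hlt
  push Not at hlt
  have h6 : 6 ≤ algBorderRank t := six_le_algBorderRank_matMulTensor_two K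
  -- an order-`h` approximate decomposition with exactly `6` triads
  obtain ⟨h, hh⟩ : ∃ h, approxRank h t = algBorderRank t :=
    Nat.sInf_mem (Set.range_nonempty fun h : ℕ => approxRank h t)
  have hr6 : approxRank h t = 6 := by omega
  have hmem : (6 : ℕ) ∈ {r : ℕ | ∃ (u : Fin r → P2 → K[X]) (v : Fin r → P2 → K[X])
      (w : Fin r → P2 → K[X]), IsApproxDecomposition h t u v w} := by
    have hm := Nat.sInf_mem (exists_isApproxDecomposition h t)
    change approxRank h t ∈ _ at hm
    rwa [hr6] at hm
  obtain ⟨u, v, w, huvw⟩ := hmem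
  -- six distinct coordinate pairs
  have hr16 : 6 ≤ Fintype.card (P2 × P2) := by
    simp [Fintype.card_prod, Fintype.card_fin]
  set pts : Fin 6 → P2 × P2 := fun ρ => (Fintype.equivFin (P2 × P2)).symm (Fin.castLE hr16 ρ)
    with hpts
  have hinj : Function.Injective fun ρ => ((pts ρ).1, (pts ρ).2) := by
    simp only [Prod.mk.eta]
    exact (Fintype.equivFin (P2 × P2)).symm.injective.comp (Fin.castLE_injective hr16)
  -- `N` beyond `h` and all degrees
  set N := h + 1 + (∑ ρ, ∑ a, (v ρ a).natDegree + ∑ ρ, ∑ b, (w ρ b).natDegree) with hN_def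
  have hNh : h < N := by omega
  have hN0 : 0 < N := by omega
  have hv : ∀ ρ a, (v ρ a).natDegree < N := by
    intro ρ a
    have h1 : (v ρ a).natDegree ≤ ∑ a, (v ρ a).natDegree :=
      Finset.single_le_sum (f := fun a => (v ρ a).natDegree) (fun _ _ => Nat.zero_le _)
        (Finset.mem_univ a)
    have h2 : ∑ a, (v ρ a).natDegree ≤ ∑ ρ, ∑ a, (v ρ a).natDegree :=
      Finset.single_le_sum (f := fun ρ => ∑ a, (v ρ a).natDegree) (fun _ _ => Nat.zero_le _)
        (Finset.mem_univ ρ)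
    omega
  have hw : ∀ ρ b, (w ρ b).natDegree < N := by
    intro ρ b
    have h1 : (w ρ b).natDegree ≤ ∑ b, (w ρ b).natDegree :=
      Finset.single_le_sum (f := fun b => (w ρ b).natDegree) (fun _ _ => Nat.zero_le _)
        (Finset.mem_univ b)
    have h2 : ∑ b, (w ρ b).natDegree ≤ ∑ ρ, ∑ b, (w ρ b).natDegree :=
      Finset.single_le_sum (f := fun ρ => ∑ b, (w ρ b).natDegree) (fun _ _ => Nat.zero_le _)
        (Finset.mem_univ ρ)
    omega
  -- the perturbed decomposition and its `(110)` limit space `F`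
  have hdec := isApproxDecomposition_pert v w (fun ρ => (pts ρ).1) (fun ρ => (pts ρ).2) N huvw hNh
  set x' := pertX v (fun ρ => (pts ρ).1) N with hx'
  set y' := pertY w (fun ρ => (pts ρ).2) N with hy'
  let L := FractionRing K[X]
  set F : Submodule K (P2 × P2 → K) := limSub K L (I11 L x' y') with hF_def
  have hcard : Fintype.card P2 * Fintype.card P2 = 16 := by
    simp [Fintype.card_prod, Fintype.card_fin]
  have hF10 : 10 ≤ Module.finrank K F := by
    have h1 := finrank_limSub_eq K L (I11 L x' y')
    have h2 := finrank_I11_ge L x' y'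
    rw [hcard] at h2
    rw [hF_def, h1]
    omega
  have hFann : F ≤ annSub t := limSub_I11_le_annSub L x' y' hdec
  -- the `(210)` and `(120)` products of `F`
  set G₁ : Submodule K (P2 × P2 × P2 → K) := ⨆ a₀ : P2, F.map (mul210 K a₀) with hG₁_def
  set G₂ : Submodule K (P2 × P2 × P2 → K) := ⨆ b₀ : P2, F.map (mul120 K b₀) with hG₂_def
  have hG₁ : Module.finrank K G₁ ≤ 34 := by
    have hle : G₁ ≤ limSub K L (I21 L x' y') := iSup_le fun a₀ => map_mul210_limSub_le L x' y' a₀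
    have h1 := finrank_limSub_eq K L (I21 L x' y')
    have h2 := finrank_I21_pert_add_le L hinj hv hw hN0
    rw [← hx', ← hy'] at h2
    have h3 := finrank_symA_le L
    have h4 := Submodule.finrank_mono hle
    omega
  have hG₂ : Module.finrank K G₂ ≤ 34 := by
    have hle : G₂ ≤ limSub K L (I12 L x' y') := iSup_le fun b₀ => map_mul120_limSub_le L x' y' b₀
    have h1 := finrank_limSub_eq K L (I12 L x' y')
    have h2 := finrank_I12_pert_add_le L hinj hv hw hN0
    rw [← hx', ← hy'] at h2
    have h3 := finrank_symB_le L
    have h4 := Submodule.finrank_mono hle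
    omega
  -- the torus degeneration of `F` contains `≥ 10` weight vectors
  set S := Finset.univ.filter fun k : Fin 12 => wv K k ∈ inPart deg2 F (wdeg k) with hS_def
  have hS : 10 ≤ S.card := hF10.trans (finrank_le_card_weightLines hFann)
  -- but those fail a test
  rcases rank_test_ge K S hS with h35 | h35
  · set InG : Submodule K (P2 × P2 × P2 → K) :=
      ⨆ i ∈ Finset.range 20, inPart deg3A G₁ (-4 + i) with hInG
    have hspan : Submodule.span K (genSet K false S) ≤ InG := by
      refine Submodule.span_le.2 ?_
      rintro _ ⟨k, hk, a₀, rfl⟩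
      rw [hS_def, Finset.mem_filter] at hk
      rw [rowFun_false]
      have h1 : mul210 K a₀ (wv K k) ∈ inPart deg3A G₁ (wdeg k + degA a₀) := by
        refine inPart_mono deg3A (le_iSup (fun a₀ : P2 => F.map (mul210 K a₀)) a₀) _ ?_
        exact map_inPart_le deg2 deg3A (mul210 K a₀) (degA a₀) (mul210_mem_Vge K a₀)
          (projDeg_mul210 K a₀) F (wdeg k) (Submodule.mem_map_of_mem hk.2)
      have hwin := wdeg_add_degA_window k a₀
      obtain ⟨i, hi, hieq⟩ : ∃ i : ℕ, i ∈ Finset.range 20 ∧ (-4 : ℤ) + i = wdeg k + degA a₀ :=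
        ⟨(wdeg k + degA a₀ + 4).toNat, by rw [Finset.mem_range]; omega, by omega⟩
      rw [← hieq] at h1
      exact (le_iSup₂ (f := fun i (_ : i ∈ Finset.range 20) => inPart deg3A G₁ (-4 + i)) i hi) h1
    have hIn := finrank_biSup_inPart_le deg3A G₁ (-4) 20 (fun t => (deg3A_window t).1)
      (fun t => (deg3A_window t).2)
    have := (Submodule.finrank_mono hspan).trans hIn
    omega
  · set InG : Submodule K (P2 × P2 × P2 → K) :=
      ⨆ i ∈ Finset.range 15, inPart deg3B G₂ (-2 + i) with hInG
    have hspan : Submodule.span K (genSet K true S) ≤ InG := by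
      refine Submodule.span_le.2 ?_
      rintro _ ⟨k, hk, b₀, rfl⟩
      rw [hS_def, Finset.mem_filter] at hk
      rw [rowFun_true]
      have h1 : mul120 K b₀ (wv K k) ∈ inPart deg3B G₂ (wdeg k + degB b₀) := by
        refine inPart_mono deg3B (le_iSup (fun b₀ : P2 => F.map (mul120 K b₀)) b₀) _ ?_
        exact map_inPart_le deg2 deg3B (mul120 K b₀) (degB b₀) (mul120_mem_Vge K b₀)
          (projDeg_mul120 K b₀) F (wdeg k) (Submodule.mem_map_of_mem hk.2)
      have hwin := wdeg_add_degB_window k b₀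
      obtain ⟨i, hi, hieq⟩ : ∃ i : ℕ, i ∈ Finset.range 15 ∧ (-2 : ℤ) + i = wdeg k + degB b₀ :=
        ⟨(wdeg k + degB b₀ + 2).toNat, by rw [Finset.mem_range]; omega, by omega⟩
      rw [← hieq] at h1
      exact (le_iSup₂ (f := fun i (_ : i ∈ Finset.range 15) => inPart deg3B G₂ (-2 + i)) i hi) h1
    have hIn := finrank_biSup_inPart_le deg3B G₂ (-2) 15 (fun t => (deg3B_window t).1)
      (fun t => (deg3B_window t).2)
    have := (Submodule.finrank_mono hspan).trans hIn
    omega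

end Main

end MatMulTwo

end Literature.Computability.AlgebraicComplexity

end
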